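import Summits.Ventures.QEC.Census.CertCoverBatch
import Summits.Ventures.QEC.Census.TwoBGA.TB_l6m24_A0_0_0_1_3_11_B0_0_1_11_5_4.CoreDefs
import HarnessLib

set_option Elab.async false
set_option maxRecDepth 200000

/-!
# `[[288,12,16]]` one-level cover certificate of `TB_l6m24_A0_0_0_1_3_11_B0_0_1_11_5_4` — LEVEL-1→0 coset problems 40…53 (deep problems [5] excluded: `ProbDeep*.lean`) as COMPACT data
(`ProbData`: U, f, σ, y₀, allow; qec-type-10 `CertCoverBatch.mkCoset` rebuilds each `CosetProb` in the kernel) + their verdict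
`probsOK cov covR hx hx1 D1 lxd 14` (one `decide +kernel`; 14 problems, depths f=0:10 f=1:3 f=2:1 f=3:0, est. 99.0 s).
qec-search-1 g5 (pattern of search-9 g5 `Probs*`); data from JSON `level10.problems` (sha256 fee0559d1bce5e88…). Data + decided check; KERNEL.
-/

namespace Summit.Ventures.QEC.Census.TB_l6m24_A0_0_0_1_3_11_B0_0_1_11_5_4

open Matrix Summit.Ventures.QEC.Census Literature.InformationTheory.QuantumCodes

/-- Problems 40…53 (14): `⟨U, f, σ, y₀, allow⟩`. -/
def probs04 : List ProbData := [
    ⟨1333122277850014437763645346492186625, 1, 864691128857788432, 1333122277849938879323458679596908545, [0]⟩,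
    ⟨1334420352064629273075129263367127049, 2, 27670117210088538112, 56668397794435742564360, [0, 8388608]⟩,
    ⟨1335069389181622257757938487665885192, 0, 29975960356742236160, 1334420352064577327043817697269776384, [0]⟩,
    ⟨1335393907725585663933662578429919241, 0, 27886289992302985220, 1335393907725547884857684433125244929, [0]⟩,
    ⟨1336367463386542054792195893492711433, 0, 28102462774517432328, 18889754161854866784264, [0]⟩,
    ⟨1337016470822116094298755782508808192, 0, 442721857907273501728, 38837037103025279566088192, [0]⟩,
    ⟨1337016500493887251379800809100279821, 0, 23058431741414866944, 1337016500493840027714972112648142849, [0]⟩,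
    ⟨1337016500493991115772590405760057345, 1, 805314592, 7788445287802241443078318982168576, [0]⟩,
    ⟨1339612629212894814847657790423433234, 0, 940783950374830620674, 1339612629116066822187087951378251778, [0]⟩,
    ⟨1339612648923220787548198269156855825, 1, 55340797370105331712, 10384593717069692150549140077543424, [0]⟩,
    ⟨1339612648923466332159128567040442377, 0, 27670117211699167296, 358899852698094109982728, [0]⟩,
    ⟨1339612648923938624148212898454315041, 0, 110681594743431921792, 1329228055206868895103045313004314657, [0]⟩,
    ⟨1344804916110069451469848878480623616, 0, 442721857908078832704, 15576890614290404261730088346716160, [0]⟩,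
    ⟨1344804926071618500241454175285678082, 0, 885444278906242728002, 1344804925974601612921569549358202882, [0]⟩]

set_option maxHeartbeats 400000000 in
/-- Every problem of this chunk passes (`mkCoset` elimination + `cosetOKD` + fast `σ` + depth + `BU`-evenness + label checks). -/
theorem probs04_ok : probsOK TB_l6m24_A0_0_0_1_3_11_B0_0_1_11_5_4.cov covR hx hx1 D1 lxd 14 probs04 = true := by
  decide +kernel

/-- Pointwise form. -/
theorem probs04_all : ∀ x ∈ TB_l6m24_A0_0_0_1_3_11_B0_0_1_11_5_4.probs04, probOK cov covR hx hx1 D1 lxd 14 x = true := by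
  have h := probs04_ok
  rwa [probsOK, List.all_eq_true] at h

end Summit.Ventures.QEC.Census.TB_l6m24_A0_0_0_1_3_11_B0_0_1_11_5_4
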